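import Mathlib
import Literature.Computability.Complexity.Promise
import Literature.Computability.Complexity.PolynomialEntropyApproximation
import Literature.Computability.MetaComplexity.HeuristicClasses
import Literature.Computability.Cryptography.Indistinguishability

/-!
# Sketch — first lemmas for the crux-idea cards on `SzkEntropy.PeaWorstToAvg` (stmt-PneNP-10777)

Planner scratch file (crux-ideate round 1, ideator 1).  Nothing here is proved; every `theorem`
is a FIRST LEMMA of an idea card and only has to elaborate.  `PEA 3` below is
`Literature.Computability.Complexity.PEA 3`, definitionally (`Iff.rfl`) the `let ev/H/PEA := …; PEA 3`
spelled inline in the route file, so `Conclusion` is definitionally the consequent of the crux.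
-/

namespace Summit.PneNP.PneNP.Cruxes.PeaWorstToAvg.Sketch

open Literature.Computability.Complexity Literature.Computability.MetaComplexity

/-- The consequent of the crux `PeaWorstToAvg`: a polynomial-time samplable, promise-supported
ensemble on which `PEA₃` is not in `HeurBPP`. -/
def Conclusion : Prop :=
  ∃ D : Literature.Computability.MetaComplexity.Ensemble, D.IsPolySamplable ∧
    (∀ n : ℕ, ∀ w ∈ (D n).support, w ∈ (PEA 3).yes ∨ w ∈ (PEA 3).no) ∧
    DistProblem.mk (PEA 3).yes D ∉ HeurBPP

/-! ## Card A — `orbit-pair-rsr` -/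

/-- Output vector of a sparse map `P : F₂ⁿ → F₂^m`, `m = P.length`. -/
def outVec {n : ℕ} (P : PolyMapF2 n) (x : Fin n → ZMod 2) : Fin P.length → ZMod 2 :=
  fun i => (P.eval x).getD i 0

/-- Semantic affine equivalence of sparse maps on the same variables: `Q = (B · + c) ∘ P ∘ (A · + b)`
as functions `F₂ⁿ → F₂^m`, with `A ∈ GLₙ(F₂)`, `B ∈ GL_m(F₂)`.  Entropy is EXACTLY invariant
(`mapEntropy_comp_of_injOn`, `mapEntropy_univ_comp_equiv`). -/
def AffEquiv {n : ℕ} (P Q : PolyMapF2 n) : Prop :=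
  ∃ hlen : Q.length = P.length,
  ∃ (A : Matrix (Fin n) (Fin n) (ZMod 2)) (b : Fin n → ZMod 2)
    (B : Matrix (Fin P.length) (Fin P.length) (ZMod 2)) (c : Fin P.length → ZMod 2),
    IsUnit A ∧ IsUnit B ∧
      ∀ x : Fin n → ZMod 2,
        (fun i : Fin P.length => outVec Q x (Fin.cast hlen.symm i)) =
          B.mulVec (outVec P (A.mulVec x + b)) + c

/-- The ORBIT-PAIR promise problem of two explicit sequences of cubic maps `p₀ s, p₁ s : F₂ˢ → F₂^m`
(padded so that the number of variables is the size index `s`) with thresholds `k s`: on PEA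
instances `⟨s, (q, j)⟩`, YES iff `j = k s`, `deg q ≤ 3` and `q` is affinely equivalent to `p₁ s`;
NO iff the same with `p₀ s`.  (Hidden affine equivalence of cubic maps = Patarin's IP2S /
tensor-isomorphism world, here with an ENTROPY GAP between the two orbits.) -/
noncomputable def OrbitPair (p₀ p₁ : (s : ℕ) → PolyMapF2 s) (k : ℕ → ℕ) : PromiseProblem :=
  PromiseProblem.ofEncoding PEAInst.encoding
    {I | I.2.2 = k I.1 ∧ PolyMapF2.DegLE 3 I.2.1 ∧ AffEquiv (p₁ I.1) I.2.1}
    {I | I.2.2 = k I.1 ∧ PolyMapF2.DegLE 3 I.2.1 ∧ AffEquiv (p₀ I.1) I.2.1}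

/-- `P`-uniformity of an explicit sequence of instances: `1ˢ ↦ ⟨s, (p s, k s)⟩` is in `FP`. -/
def IsPUniform (p : (s : ℕ) → PolyMapF2 s) (k : ℕ → ℕ) : Prop :=
  ∃ f ∈ FP, ∀ s : ℕ, f (Computability.unaryEncodeNat s) = PEAInst.encoding.encode ⟨s, (p s, k s)⟩

/-- **Card A, first lemma (orbit random self-reduction).**  For any two `P`-uniform sequences of
cubic maps separated in entropy across the threshold `k`, worst-case hardness of telling the two
affine orbits apart already gives the crux's conclusion: `D` = "fair coin `b`, near-uniform
`(A, b', B, c) ∈ Aff_s × Aff_m`, output `⟨s, ((B·+c) ∘ p_b s ∘ (A·+b'), k s)⟩`" is samplable,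
supported on the promise (entropy is exactly orbit-invariant), and a `HeurBPP` scheme for it with
error `≤ 1/8` decides `OrbitPair` in the worst case by re-randomising the input inside its own
orbit and taking a majority vote. -/
theorem conclusion_of_orbitPair_not_mem_PromiseBPP'
    (p₀ p₁ : (s : ℕ) → PolyMapF2 s) (k : ℕ → ℕ)
    (hu₀ : IsPUniform p₀ k) (hu₁ : IsPUniform p₁ k)
    (hdeg₀ : ∀ s, (p₀ s).DegLE 3) (hdeg₁ : ∀ s, (p₁ s).DegLE 3)
    (hH₀ : ∀ s, (p₀ s).entropy ≤ k s) (hH₁ : ∀ s, (k s : ℝ) + 1 ≤ (p₁ s).entropy)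
    (hhard : OrbitPair p₀ p₁ k ∉ PromiseBPP') : Conclusion := by
  sorry

/-- **Card A, transfer shape.**  The crux follows from ONE worst-case (Karp) hardness transfer:
a polynomial-time promise reduction from `PEA₃` onto an entropy-separated orbit pair.  (Closure of
`PromiseBPP'` under Karp reductions is the tree's `mem_PromiseBPP'_of_polyTimeReducible_holds`.) -/
theorem peaWorstToAvg_of_orbitPair_transfer
    (p₀ p₁ : (s : ℕ) → PolyMapF2 s) (k : ℕ → ℕ)
    (hu₀ : IsPUniform p₀ k) (hu₁ : IsPUniform p₁ k)
    (hdeg₀ : ∀ s, (p₀ s).DegLE 3) (hdeg₁ : ∀ s, (p₁ s).DegLE 3)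
    (hH₀ : ∀ s, (p₀ s).entropy ≤ k s) (hH₁ : ∀ s, (k s : ℝ) + 1 ≤ (p₁ s).entropy)
    (hred : (PEA 3).PolyTimeReducible (OrbitPair p₀ p₁ k)) :
    PEA 3 ∉ PromiseBPP' → Conclusion := by
  sorry

/-! ## Card B — `dual-mode-compile` -/

/-- **Card B, first lemma (dual-mode compile).**  Two polynomial-time samplable ensembles of
`PEA₃` instances, one supported on NO instances and one on YES instances, that are
computationally indistinguishable, give the crux's conclusion (`D` = fair mixture; a `HeurBPP`
scheme with `m = 8` is a distinguisher with constant advantage at every length).  Lossy /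
dual-mode function families with log-space evaluation compile into such `(K₀, K₁)` through AIK
perfect degree-3 encodings (`H(p̂) = H(p) + |r|` exactly, support on the promise by syntactic
mode certificates). -/
theorem conclusion_of_dualMode
    (K₀ K₁ : Literature.Computability.MetaComplexity.Ensemble)
    (hK₀ : K₀.IsPolySamplable) (hK₁ : K₁.IsPolySamplable)
    (h₀ : ∀ n : ℕ, ∀ w ∈ (K₀ n).support, w ∈ (PEA 3).no)
    (h₁ : ∀ n : ℕ, ∀ w ∈ (K₁ n).support, w ∈ (PEA 3).yes)
    (hind : Literature.Computability.Cryptography.IsCompIndistinguishable K₀ K₁) :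
    Conclusion := by
  sorry

/-- **Card B, transfer shape.**  The crux follows from: worst-case hardness of `PEA₃` yields an
(i.o.-)indistinguishable promise-separated samplable pair of cubic-map ensembles — a
primitive-existence statement ("dual-mode / lossy family from worst-case `SZK_L` hardness"). -/
theorem peaWorstToAvg_of_dualMode_transfer
    (h : PEA 3 ∉ PromiseBPP' →
      ∃ K₀ K₁ : Literature.Computability.MetaComplexity.Ensemble,
        K₀.IsPolySamplable ∧ K₁.IsPolySamplable ∧
        (∀ n : ℕ, ∀ w ∈ (K₀ n).support, w ∈ (PEA 3).no) ∧
        (∀ n : ℕ, ∀ w ∈ (K₁ n).support, w ∈ (PEA 3).yes) ∧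
        Literature.Computability.Cryptography.IsCompIndistinguishable K₀ K₁) :
    PEA 3 ∉ PromiseBPP' → Conclusion := by
  sorry

end Summit.PneNP.PneNP.Cruxes.PeaWorstToAvg.Sketch
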